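import Mathlib
import Literature.AlgebraicGeometry.Resolution.TranscendenceDefect
import Literature.AlgebraicGeometry.Resolution.LocalBlowup
import Literature.AlgebraicGeometry.Resolution.AbhyankarMonomialUniformization
import Summits.ResolutionOfSingularities.ResolutionOfSingularities.Theorems.RadicialJungCleanModelsCleanLUOfMonomialModel
import Summits.ResolutionOfSingularities.ResolutionOfSingularities.Theorems.RadicialJungCleanModelsCleanLU3Abhyankar
import Summits.ResolutionOfSingularities.ResolutionOfSingularities.Theorems.RadicialJungCleanModelsLens5TFrameSepBridge
import HarnessLib

/-!
# Route `RadicialJung`, crux `CleanModels` (stmt-15917), line `Sketch` rev 35, stub 7 `stub_cleanModelsDimGEFour`: the ABHYANKAR class of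
# clean local uniformization, in EVERY dimension, from PRINT — Knaf–Kuhlmann 2005 Thm. 1.1 WITH its monomiality clause

Explicit-unit seat `decomp-res-hand-2` g2 (structural hand, stubs 5–7).  OURS; nothing here proves resolution in characteristic `p`.

The dim-`d` local input `hAbh_d` of `…CleanLUDimCases` (clean LU of the `K^p`-line of `g₀` at a zero-dimensional ABHYANKAR valuation with a
`d`-dimensional regular finitely generated centre) is discharged in `…CleanLUDimDefectless.lean` modulo the OPEN embedded-resolution hypothesis
`hEmb_{d−1}`.  Here it is RE-SOURCED TO PRINT for valuations whose residue field is separable over the ground field (in particular over every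
PERFECT ground field): Knaf–Kuhlmann 2005, Thm. 1.1 — "Abhyankar places admit local uniformization in any characteristic" — INCLUDING its
«Moreover» clause (the prescribed finite set `Z` becomes MONOMIALS in a regular system of parameters at the centre), which the tree's
`Literature.AlgebraicGeometry.Resolution.KnafKuhlmann2005_Thm11` (PROVED there, `KnafKuhlmann2005_Thm11_holds`) deliberately does not vendor.
The clause is the named fact `Literature.AlgebraicGeometry.Resolution.KnafKuhlmann2005_Thm11_monomial` (`AbhyankarMonomialUniformization.lean`,
✓ p792590, typed by this seat and relocated by the gate; special case: residue field extension ALGEBRAIC, the only case met at zero-dimensional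
valuations), carried as a hypothesis; then

* `cleanLUAbh_of_kk05` — `hAbh_d`'s conclusion (any `d`; no regularity or dimension hypothesis on the given model `A` is needed) for an
  Abhyankar `O` all of whose centres above `A` are closed points and whose residue field is separable over `k`: Kuhlmann's generalized
  stability theorem (✓ `Kuhlmann2010Stability_holds`) ⟹ best `p`-th-power approximation `f₀` (✓ `exists_isMin_pthPowerApprox_of_isDefectlessField`);
  `g₀ − f₀^p = x / y` with `x, y ∈ A`; KK05 with `Z = ` generators of `A` `∪ {x, y}` ⟹ a model `A' ⊇ A`, regular at the centre, with `x`, `y`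
  monomials there; read-off ✓ `cleanLUConcl_of_isMin_pthPowerApprox_of_monomial_num_den`;
* `cleanLUAbh_of_kk05_of_perfectField` — the same over a PERFECT ground field (the residue field is algebraic over `k` by
  ✓ `Lens5TFrame.isAlgebraic_residueField_of_centres_maximal`, hence separable);
* `hAbh_dim_of_kk05_of_perfectField` — packaged in the exact shape of the input `hAbh_d` of ✓ `cleanLUZeroDim_dim_of_cases`, every `d`, over
  perfect ground fields.

Census consequence: over a perfect ground field the Abhyankar column of stub 7 (every `d ≥ 4`; and of the dim-3 node) is PRINTED-conditional
(KK05 Thm. 1.1 in full) instead of conditional on open embedded resolution; `hEmb_{d−1}` remains needed for the non-Abhyankar defectless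
valuations (`hBest_d`).
-/

noncomputable section

set_option linter.dupNamespace false -- mandated namespace of this single-conjunct summit

open IsLocalRing AlgebraicGeometry CategoryTheory
open Literature.AlgebraicGeometry.Resolution

namespace Summit.ResolutionOfSingularities.ResolutionOfSingularities.Theorems.RadicialJung.CleanModels

/-- **The Abhyankar class of clean local uniformization from Knaf–Kuhlmann 2005 Thm. 1.1 (with monomiality), any dimension.**  Let `k` have
characteristic `p`, `K ⊇ k`, `O` a valuation ring of `K`, `A ⊆ O` a finitely generated `k`-subalgebra with fraction field `K` above which every
centre of `O` is a closed point, `O` ABHYANKAR over `k` (transcendence defect `0`) with residue field SEPARABLE over `k` (for the structure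
`k → O → κ(O)`), and `g₀ ∉ K^p`.  Then, granted `KnafKuhlmann2005_Thm11_monomial`, there is a finitely generated `A ⊆ A' ⊆ O`, regular at the
centre of `O`, carrying there a loosely clean non-trivial representative of the `K^p`-line of `g₀` — the conclusion of the line's dim-`d` local
input `hAbh_d`, with no hypothesis on the dimension or regularity of `A`.
[cite: KnafKuhlmann2005, Thm. 1.1] [cite: Kuhlmann2010, Thm. 1.1] -/
theorem cleanLUAbh_of_kk05 (hKK : Literature.AlgebraicGeometry.Resolution.KnafKuhlmann2005_Thm11_monomial.{0})
    (p : ℕ) (hp : p.Prime) (k : Type) [Field k] [CharP k p] (K : Type) [Field K] [Algebra k K]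
    (O : ValuationSubring K) (A : Subalgebra k K) (hAO : A.toSubring ≤ O.toSubring) (hAfg : A.FG)
    (hfrac : IsFractionRing A K)
    (g₀ : K) (hg₀ : ∀ c : K, c ^ p ≠ g₀)
    (hk : ∀ c : k, algebraMap k K c ∈ O) (htd : transcendenceDefect k O hk = 0)
    (hsep : @Algebra.IsSeparable k (ResidueField O) _ _
      ((IsLocalRing.residue O).comp ((algebraMap k K).codRestrict O hk)).toAlgebra) :
    ∃ (A' : Subalgebra k K), A'.toSubring ≤ O.toSubring ∧ A ≤ A' ∧ A'.FG ∧
      ∃ (_ : IsRegularLocalRing (locAtCentre A'.toSubring O)) (c : Fin p → K),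
        (∃ j : Fin p, (j : ℕ) ≠ 0 ∧ c j ≠ 0) ∧
        ((∃ (d m : ℕ) (hmd : m ≤ d) (t : Fin d → ↥(locAtCentre A'.toSubring O)) (a : Fin m → ℕ)
            (u : ↥(locAtCentre A'.toSubring O)), IsUnit u ∧
            Ideal.span (Set.range t) = IsLocalRing.maximalIdeal ↥(locAtCentre A'.toSubring O) ∧
            ringKrullDim ↥(locAtCentre A'.toSubring O) = (d : WithBot ℕ∞) ∧ 0 < m ∧ (∀ i, ¬ p ∣ a i) ∧
            (∑ j : Fin p, c j ^ p * g₀ ^ (j : ℕ)) =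
              (u : K) * ∏ i : Fin m, ((t (Fin.castLE hmd i) : ↥(locAtCentre A'.toSubring O)) : K) ^ (a i)) ∨
          (∃ u : ↥(locAtCentre A'.toSubring O), IsUnit u ∧ (∑ j : Fin p, c j ^ p * g₀ ^ (j : ℕ)) = (u : K) ∧
            ∀ c' : ↥(locAtCentre A'.toSubring O), u - c' ^ p ∉ IsLocalRing.maximalIdeal ↥(locAtCentre A'.toSubring O)) ∨
          (∃ s c' : ↥(locAtCentre A'.toSubring O), (∑ j : Fin p, c j ^ p * g₀ ^ (j : ℕ)) = (s : K) ∧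
            s - c' ^ p ∈ IsLocalRing.maximalIdeal ↥(locAtCentre A'.toSubring O) ∧
            s - c' ^ p ∉ IsLocalRing.maximalIdeal ↥(locAtCentre A'.toSubring O) ^ 2)) := by
  classical
  haveI : Fact p.Prime := ⟨hp⟩
  haveI : CharP K p := charP_of_injective_algebraMap (algebraMap k K).injective p
  -- best `p`-th-power approximation (Kuhlmann's generalized stability theorem)
  have hdef : IsDefectlessField K O := Kuhlmann2010Stability_holds k K (intermediateField_top_fg A hAfg hfrac) O hk htd
  obtain ⟨f₀, hmin⟩ := exists_isMin_pthPowerApprox_of_isDefectlessField O hdef g₀ hg₀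
  -- the remainder as a fraction of elements of `A`
  obtain ⟨x, y, hy, hxy⟩ := IsFractionRing.div_surjective (A := A) (g₀ - f₀ ^ p)
  have hxy' : g₀ - f₀ ^ p = (x : K) / (y : K) := hxy.symm
  -- Knaf–Kuhlmann with `Z = generators of A ∪ {x, y}`
  obtain ⟨s₀, hs₀⟩ := hAfg
  let Z : Finset K := s₀ ∪ {(x : K), (y : K)}
  have hZO : ∀ z ∈ Z, z ∈ O := by
    intro z hz
    rcases Finset.mem_union.mp hz with hz | hz
    · exact hAO (hs₀ ▸ Algebra.subset_adjoin hz : z ∈ A)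
    · rcases Finset.mem_insert.mp hz with rfl | hz
      · exact hAO x.2
      · rw [Finset.mem_singleton] at hz
        rw [hz]
        exact hAO y.2
  obtain ⟨A', hA'fg, hA'O, -, hZA', hreg, d, a, hspan, hdim, hmono⟩ :=
    hKK k K (intermediateField_top_fg A ⟨s₀, hs₀⟩ hfrac) O hk htd hsep Z hZO
  have hAA' : A ≤ A' := by
    rw [← hs₀, Algebra.adjoin_le_iff]
    intro z hz
    exact hZA' z (Finset.mem_union_left _ hz)
  have hA'R : A'.toSubring ≤ locAtCentre A'.toSubring O := le_locAtCentre A'.toSubring O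
  have hxZ : (x : K) ∈ Z := Finset.mem_union_right _ (Finset.mem_insert_self _ _)
  have hyZ : (y : K) ∈ Z :=
    Finset.mem_union_right _ (Finset.mem_insert_of_mem (Finset.mem_singleton_self _))
  obtain ⟨u₁, β, hu₁, hx⟩ := hmono (x : K) hxZ
  obtain ⟨u₂, γ, hu₂, hy'⟩ := hmono (y : K) hyZ
  let x₂ : locAtCentre A'.toSubring O := ⟨x, hA'R (hAA' x.2)⟩
  let y₂ : locAtCentre A'.toSubring O := ⟨y, hA'R (hAA' y.2)⟩
  have hx₂ : x₂ = u₁ * ∏ i, a i ^ β i := by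
    apply Subtype.ext
    change (x : K) = _
    rw [hx]
    push_cast
    rfl
  have hy₂ : y₂ = u₂ * ∏ i, a i ^ γ i := by
    apply Subtype.ext
    change (y : K) = _
    rw [hy']
    push_cast
    rfl
  exact cleanLUConcl_of_isMin_pthPowerApprox_of_monomial_num_den p hp k K O A g₀ f₀ hmin A' hA'O hAA' hA'fg hreg a hspan
    hdim x₂ y₂ hxy' β γ u₁ u₂ hu₁ hu₂ hx₂ hy₂

/-- **The Abhyankar class over a PERFECT ground field, from Knaf–Kuhlmann 2005 Thm. 1.1 (with monomiality), any dimension**: when every centre of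
`O` above `A` is a closed point, the residue field `κ(O)` is algebraic over `k` (✓ `Lens5TFrame.isAlgebraic_residueField_of_centres_maximal`,
Zariski's lemma), hence separable over a perfect `k`, and `cleanLUAbh_of_kk05` applies. [cite: KnafKuhlmann2005, Thm. 1.1] -/
theorem cleanLUAbh_of_kk05_of_perfectField (hKK : Literature.AlgebraicGeometry.Resolution.KnafKuhlmann2005_Thm11_monomial.{0})
    (p : ℕ) (hp : p.Prime) (k : Type) [Field k] [CharP k p] [PerfectField k] (K : Type) [Field K] [Algebra k K]
    (O : ValuationSubring K) (A : Subalgebra k K) (hAO : A.toSubring ≤ O.toSubring) (hAfg : A.FG)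
    (hfrac : IsFractionRing A K)
    (hzd : ∀ (T : Subring K) (hT : T ≤ O.toSubring), A.toSubring ≤ T → (subringCentre T O hT).IsMaximal)
    (g₀ : K) (hg₀ : ∀ c : K, c ^ p ≠ g₀)
    (hk : ∀ c : k, algebraMap k K c ∈ O) (htd : transcendenceDefect k O hk = 0) :
    ∃ (A' : Subalgebra k K), A'.toSubring ≤ O.toSubring ∧ A ≤ A' ∧ A'.FG ∧
      ∃ (_ : IsRegularLocalRing (locAtCentre A'.toSubring O)) (c : Fin p → K),
        (∃ j : Fin p, (j : ℕ) ≠ 0 ∧ c j ≠ 0) ∧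
        ((∃ (d m : ℕ) (hmd : m ≤ d) (t : Fin d → ↥(locAtCentre A'.toSubring O)) (a : Fin m → ℕ)
            (u : ↥(locAtCentre A'.toSubring O)), IsUnit u ∧
            Ideal.span (Set.range t) = IsLocalRing.maximalIdeal ↥(locAtCentre A'.toSubring O) ∧
            ringKrullDim ↥(locAtCentre A'.toSubring O) = (d : WithBot ℕ∞) ∧ 0 < m ∧ (∀ i, ¬ p ∣ a i) ∧
            (∑ j : Fin p, c j ^ p * g₀ ^ (j : ℕ)) =
              (u : K) * ∏ i : Fin m, ((t (Fin.castLE hmd i) : ↥(locAtCentre A'.toSubring O)) : K) ^ (a i)) ∨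
          (∃ u : ↥(locAtCentre A'.toSubring O), IsUnit u ∧ (∑ j : Fin p, c j ^ p * g₀ ^ (j : ℕ)) = (u : K) ∧
            ∀ c' : ↥(locAtCentre A'.toSubring O), u - c' ^ p ∉ IsLocalRing.maximalIdeal ↥(locAtCentre A'.toSubring O)) ∨
          (∃ s c' : ↥(locAtCentre A'.toSubring O), (∑ j : Fin p, c j ^ p * g₀ ^ (j : ℕ)) = (s : K) ∧
            s - c' ^ p ∈ IsLocalRing.maximalIdeal ↥(locAtCentre A'.toSubring O) ∧
            s - c' ^ p ∉ IsLocalRing.maximalIdeal ↥(locAtCentre A'.toSubring O) ^ 2)) := by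
  letI alg : Algebra k (ResidueField O) := ((IsLocalRing.residue O).comp ((algebraMap k K).codRestrict O hk)).toAlgebra
  have hcomp : ∀ (c : k) (h : algebraMap k K c ∈ O),
      algebraMap k (ResidueField O) c = IsLocalRing.residue O ⟨algebraMap k K c, h⟩ := fun c h => rfl
  haveI : Algebra.IsAlgebraic k (ResidueField O) :=
    Summit.ResolutionOfSingularities.ResolutionOfSingularities.Theorems.RadicialJungCleanModels.Lens5TFrame.isAlgebraic_residueField_of_centres_maximal
      O A hAO hAfg hzd hcomp
  have hsep : Algebra.IsSeparable k (ResidueField O) := Algebra.IsAlgebraic.isSeparable_of_perfectField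
  exact cleanLUAbh_of_kk05 hKK p hp k K O A hAO hAfg hfrac g₀ hg₀ hk htd hsep

/-- **The input `hAbh_d` of ✓ `cleanLUZeroDim_dim_of_cases`, every `d`, over PERFECT ground fields, from Knaf–Kuhlmann 2005 Thm. 1.1 (with
monomiality)** — the exact hypothesis shape (its dimension and regularity binders are not used). [cite: KnafKuhlmann2005, Thm. 1.1] -/
theorem hAbh_dim_of_kk05_of_perfectField (hKK : Literature.AlgebraicGeometry.Resolution.KnafKuhlmann2005_Thm11_monomial.{0}) (d : ℕ) :
    ∀ (p : ℕ), p.Prime →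
    ∀ (k : Type) [Field k] [CharP k p] [PerfectField k] (K : Type) [Field K] [Algebra k K]
    (O : ValuationSubring K) (A : Subalgebra k K), A.toSubring ≤ O.toSubring → A.FG → IsFractionRing A K →
    ringKrullDim A ≤ (d : WithBot ℕ∞) → IsRegularLocalRing (locAtCentre A.toSubring O) →
    ringKrullDim (locAtCentre A.toSubring O) = (d : WithBot ℕ∞) →
    (∀ (T : Subring K) (hT : T ≤ O.toSubring), A.toSubring ≤ T → (subringCentre T O hT).IsMaximal) →
    ∀ g₀ : K, (∀ c : K, c ^ p ≠ g₀) →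
    ∀ hk : ∀ c : k, algebraMap k K c ∈ O, transcendenceDefect k O hk = 0 →
    ∃ (A' : Subalgebra k K), A'.toSubring ≤ O.toSubring ∧ A ≤ A' ∧ A'.FG ∧
    ∃ (_ : IsRegularLocalRing (locAtCentre A'.toSubring O)) (c : Fin p → K), (∃ j : Fin p, (j : ℕ) ≠ 0 ∧ c j ≠ 0) ∧
    ((∃ (d m : ℕ) (hmd : m ≤ d) (t : Fin d → ↥(locAtCentre A'.toSubring O)) (a : Fin m → ℕ) (u : ↥(locAtCentre A'.toSubring O)), IsUnit u ∧
    Ideal.span (Set.range t) = IsLocalRing.maximalIdeal ↥(locAtCentre A'.toSubring O) ∧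
    ringKrullDim ↥(locAtCentre A'.toSubring O) = (d : WithBot ℕ∞) ∧ 0 < m ∧ (∀ i, ¬ p ∣ a i) ∧
    (∑ j : Fin p, c j ^ p * g₀ ^ (j : ℕ)) = (u : K) * ∏ i : Fin m, ((t (Fin.castLE hmd i) : ↥(locAtCentre A'.toSubring O)) : K) ^ (a i)) ∨
    (∃ u : ↥(locAtCentre A'.toSubring O), IsUnit u ∧ (∑ j : Fin p, c j ^ p * g₀ ^ (j : ℕ)) = (u : K) ∧
    ∀ c' : ↥(locAtCentre A'.toSubring O), u - c' ^ p ∉ IsLocalRing.maximalIdeal ↥(locAtCentre A'.toSubring O)) ∨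
    (∃ s c' : ↥(locAtCentre A'.toSubring O), (∑ j : Fin p, c j ^ p * g₀ ^ (j : ℕ)) = (s : K) ∧
    s - c' ^ p ∈ IsLocalRing.maximalIdeal ↥(locAtCentre A'.toSubring O) ∧
    s - c' ^ p ∉ IsLocalRing.maximalIdeal ↥(locAtCentre A'.toSubring O) ^ 2)) := by
  intro p hp k _ _ _ K _ _ O A hAO hAfg hfrac _ _ _ hzd g₀ hg₀ hk htd
  exact cleanLUAbh_of_kk05_of_perfectField hKK p hp k K O A hAO hAfg hfrac hzd g₀ hg₀ hk htd

end Summit.ResolutionOfSingularities.ResolutionOfSingularities.Theorems.RadicialJung.CleanModels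

end
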